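import Literature.MathematicalPhysics.PowerSystems.ClassicalSwingLossyExponentialStability
import Literature.MathematicalPhysics.PowerSystems.DroopMicrogridLossyStabilityPersistence
import HarnessLib

/-!
# The classical swing model with SMALL TRANSFER CONDUCTANCES: the Lyapunov-matrix certificate of the
# lossy rows is DERIVED at every cohesive lossless operating point, and local exponential stability
# modulo the rotation PERSISTS for every internal-node model whose equilibrium Jacobian is close to
# the lossless one — in particular under sufficiently small conductances (Chiang–Chu persistence,
# the «robust … persists in the presence of sufficiently small line conductances» remark, typed)

Topic `Literature/MathematicalPhysics/PowerSystems` (LADDER rungs G2 / G3.b; seat gridfusion-lit-1,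
g16); namespace `…PowerSystems.InternalNode`.  BY NAME over three files of the tree:
`ClassicalSwingSyncExponentialStability.lean` (the lossless spectral sentence
`swingJac_eig_re_neg_or_rotation`: every complex eigenpair of `J(δˢ)` has `Re μ < 0` or is the
rotation), `DroopMicrogridLossyStabilityPersistence.lean` §1 (lit-2 g14's GENERIC tools
`exists_lyapunovMatrix_of_eig_re_neg_or_smul` = Khalil Thm 4.6 necessity on the symmetry quotient,
`lyapunovIneq_of_entries_close` = robustness of the certificate, Khalil Lemma 9.1), and
`ClassicalSwingLossyExponentialStability.lean` §3
(`syncEquilibrium_locally_expStable_lossy_of_lyapunovCertificate`, ★ #265: the lossy model is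
exponentially stable modulo rotation GIVEN the certificate).  This file closes the triangle for the
classical model: the certificate that ★ #265 takes as a HYPOTHESIS is PROVED at every cohesive
lossless point, it is ROBUST, hence small losses keep exponential stability.  Everything below is
PROVED: 0 definitions, 0 named facts, 0 `sorry`, no new axiom.

SOURCES (read on the page).  [SimpsonporcoDorflerBullo2013] J. W. Simpson-Porco, F. Dörfler, F. Bullo,
Automatica 49 (2013), arXiv:1206.5033, §3 remark after Theorem 2 (held text p0010 L22): «Finally,
regarding the assumption of purely inductive lines, we note that since the eigenvalues of a matrix
are continuous functions of its entries, the exponential stability property established in Theorem 2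
is robust, and the stable synchronous solution persists in the presence of sufficiently small line
conductances [HDC-CCC:95].»  [DorflerBullo2012] arXiv:0910.5673 §I (held text p0008 L36–L40): «This
topological equivalence between (classical model) and (reduced gradient model) can also be extended
to "sufficiently small" transfer conductances [HDC-CCC:95]» ([HDC-CCC:95] = H.-D. Chiang, C. C. Chu,
IEEE TCAS-I 42 (1995) 252–265, cited p0032 L15).  [Khalil2002] H. K. Khalil, *Nonlinear Systems*,
3rd ed.: Theorem 4.6 (Lyapunov equation, necessity for Hurwitz `A`), Theorem 4.7 (indirect method),
§9.1 Lemma 9.1 / Example 9.1 (robustness of `V = xᵀPx` under perturbations of the linear part) —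
through the tree files above.  [Chiang1995] H.-D. Chiang in *Systems and Control Theory for Power
Systems* (1995), §6.1 (the lossy classical model is not a gradient system; equilibria non-hyperbolic
only through the rotation) — through `ClassicalSwingLossyExponentialStability.lean`.

RENDERING.  `d : InternalNode m` is the LOSSLESS reference data (its `G` never enters: `swingJac`
uses `C_ij = E_iE_jB_ij` only); `δˢ` is any COHESIVE angle vector (`|δˢ_i − δˢ_j| < π/2` across every
line with `C_ij > 0`) — typically the lossless operating point, but no equilibrium property of `δˢ`
is needed; `i₀` a reference machine.  A LOSSY model is ANY `d' : InternalNode m` (§3: arbitrary; §4: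
`⟨d.H, d.D, P'_m, d.E, G', d.B, d.ωs⟩`, i.e. the same machines and susceptances with conductances `G'`
and injections `P'_m`), `δˢ'` an equilibrium of `d'` (`d'.IsEquilibrium δˢ'`: `P'_mi = P_ei(δˢ')` with
the `G' cos + B sin` power flow of `ClassicalSwingModel`).  "Exponentially stable modulo rotation" is
VERBATIM the conclusion of ★ #265's theorem: `∃ ρ k λ > 0`, every solution `(δ, ω)` of `d'` with
`‖(δ(0) − δˢ', ω(0) − ω_s𝟙)‖ < ρ` satisfies, on every `[0, T]`, `‖(δ(t) − δˢ' − c𝟙, ω(t) − ω_s𝟙)‖ ≤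
k‖(δ(0) − δˢ', ω(0) − ω_s𝟙)‖e^{−λt}` for some `c` (sup norm on the phase space `Fin m ⊕ Fin m → ℝ`).

WHAT IS PROVED (0 `def`, 0 named facts, 0 `sorry`):
* §1 `swingJac_mulVec_rot` (`J(δˢ)(𝟙,0) = 0`), `weights_vecMul_swingJac` (`(D,M)ᵀJ(δˢ) = 0`, `B`
  symmetric); private `(D,M)·(𝟙,0) = ΣD_i`.
* §2 ★★★ **`exists_lyapunovCertificate_of_cohesive`**: `M, D > 0`, `B` symmetric, `C ≥ 0` connected,
  `δˢ` cohesive, any `i₀` ⇒ `∃ P` symmetric, `q₀ > 0`: `uᵀPu > 0` for `u ≠ 0` and `uᵀP(J(δˢ)u −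
  u_{ω,i₀}(𝟙,0)) ≤ −q₀uᵀu` on `{u_{δ,i₀} = 0}` — the hypothesis of ★ #265's theorem, DERIVED.
* §3 ★★★ **`lossy_expStable_modRotation_of_jacobian_close`**: same hypotheses ⇒ `∃ δ₀ > 0` such that
  EVERY `d' : InternalNode m` and every equilibrium `δˢ'` of `d'` with `|J'(δˢ')_kl − J(δˢ)_kl| ≤ δ₀`
  for all entries (`J' = swingJacG`, the lossy Jacobian) is exponentially stable modulo rotation.
* §4 ★★★ **`lossy_expStable_modRotation_of_small_conductances`**: same hypotheses ⇒ `∃ ε > 0` such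
  that for every `G'` with `|G'_ij| ≤ ε`, every `P'_m`, and every equilibrium `δˢ'` of
  `⟨H, D, P'_m, E, G', B, ω_s⟩` with `|δˢ'_i − δˢ_i| ≤ ε`: exponentially stable modulo rotation.
  (Private: the entrywise bound `|J' − J| ≤ 2εW·Σ_iM_i⁻¹`, `W = Σ_{i,k}|E_iE_k|(2|B_ik| + 1)`, from
  `|cos a − cos b| ≤ |a − b|`, `|sin| ≤ 1`.)

PROOF ROUTE.  §2: `J(𝟙,0) = 0`, `(D,M)ᵀJ = 0`, `(D,M)·(𝟙,0) = ΣD_i > 0`, `e_{δ,i₀}·(𝟙,0) = 1`, and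
the lossless spectral sentence feed lit-2's `exists_lyapunovMatrix_of_eig_re_neg_or_smul` with
`ℓ = e_{δ,i₀}`; `ℓ·J u = (Ju)_{δ,i₀} = u_{ω,i₀}` turns its correction term into ★ #265's.  §3: `δ₀ =
q₀/(2(S+1))`, `S = |ι|·Σ|P_ij|`; `lyapunovIneq_of_entries_close` gives the certificate for `J'` with
margin `q₀/2` (the correction term `u_{ω,i₀}(𝟙,0)` does not depend on the model); then ★ #265's
theorem for `d'`.  §4: `ε = δ₀/(2W·ΣM⁻¹ + 1)`.  In-seat float sanity check of §4's private entry bound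
(`negtest/swing_persistence_check.py`, 3 000 random instances, `m ≤ 6`): 0 violations, the bound is
conservative by a factor ≥ 9 on the sample.

THREE COLUMNS.  CERTIFIED (kernel theorems): the three starred statements above, for the exact
classical network-reduced swing model of `ClassicalSwingModel` / `ClassicalSwingLossyExponentialStability`
(`M_iδ̈_i + D_iδ̇_i = P_mi − Σ_j E_iE_j(G_ij cos δ_ij + B_ij sin δ_ij)`, rotor speeds relative to `ω_s`).
MODELLED: «classical network-reduced multimachine model with constant voltages behind transient
reactance, loads as constant impedances folded into the reduced admittance matrix (transfer
conductances `G'`), machine dampings `D_i > 0`» — the persistence statement is about THIS model's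
equilibria near a cohesive lossless angle vector.  VALIDATED: nothing numerical.  NOT CLAIMED: the
EXISTENCE of a lossy equilibrium near `δˢ` (implicit-function half of Chiang–Chu's persistence; the
statements cover whatever equilibrium the lossy model has within `ε`), any explicit value of `ε`
beyond the formula through the (existential) certificate `P, q₀`, the topological-equivalence /
stability-boundary part of [HDC-CCC:95], transfer conductances that are not small, structure-
preserving (non-reduced) models.

## References
* [SimpsonporcoDorflerBullo2013] J. W. Simpson-Porco, F. Dörfler, F. Bullo, *Synchronization and power
  sharing for droop-controlled inverters in islanded microgrids*, Automatica 49 (2013) 2603–2611,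
  arXiv:1206.5033 — §3, remark after Theorem 2 (p0010 L22).
* [DorflerBullo2012] F. Dörfler, F. Bullo, SIAM J. Control Optim. 50 (2012), arXiv:0910.5673 — §I
  (p0008 L36–L40), reference [HDC-CCC:95] (p0032 L15).
* [Khalil2002] H. K. Khalil, *Nonlinear Systems*, 3rd ed., Prentice Hall 2002 — Thm 4.6, Thm 4.7,
  §9.1 Lemma 9.1 / Example 9.1.
* [Chiang1995] H.-D. Chiang, *Systems and Control Theory for Power Systems* (IMA Vol. 64, 1995), §6.1.
* [DorflerChertkovBullo2013] F. Dörfler, M. Chertkov, F. Bullo, PNAS 110 (2013), SI §2–§3.1.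
* [SchifferEtAl2014] J. Schiffer et al., Automatica 50 (2014), §5.2 (reference node).
-/

noncomputable section

open Set Filter Topology Finset
open scoped Matrix BigOperators

namespace Literature.MathematicalPhysics.PowerSystems

namespace InternalNode

variable {m : ℕ} {d : InternalNode m}

/-! ### §1. Structural identities of the lossless Jacobian: `J·(𝟙,0) = 0`, `(D,M)ᵀJ = 0` -/

/-- The rotation `(𝟙, 0)` is in the kernel of the lossless Jacobian («rotational symmetry … the
zero eigenvalue with eigenvector `1_n`»).
[cite: DorflerChertkovBullo2013, SI §3.1 Lemma 2 and its proof (rotational symmetry of the linearisation)] -/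
theorem swingJac_mulVec_rot (δs : Fin m → ℝ) : d.swingJac δs *ᵥ rot = 0 := by
  funext k
  cases k with
  | inl i => rw [swingJac_mulVec_inl]; rfl
  | inr i =>
    rw [swingJac_mulVec_inr]
    simp [rot]

/-- The weights `(D, M)` of the first integral are a LEFT null covector of the lossless Jacobian
(`B` symmetric, `M_i ≠ 0`): `(D, M)ᵀ J(δˢ) = 0`.
[cite: DorflerChertkovBullo2013, SI §2 (summing the equations); folklore] -/
theorem weights_vecMul_swingJac (hM : ∀ i, d.M i ≠ 0) (hB : ∀ i j, d.B i j = d.B j i)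
    (δs : Fin m → ℝ) : d.weights ᵥ* d.swingJac δs = 0 := by
  have hrow : ∀ j, ∑ i, d.toDroopNetwork.lap δs j i = 0 := by
    intro j
    have h := DroopNetwork.lap_mulVec (N := d.toDroopNetwork) δs (fun _ => (1 : ℝ)) j
    simp only [sub_self, mul_zero, Finset.sum_const_zero] at h
    simpa [Matrix.mulVec, dotProduct] using h
  funext k
  rw [Matrix.vecMul, dotProduct, Fintype.sum_sum_type, Pi.zero_apply]
  cases k with
  | inl j =>
    have h1 : ∀ i, d.weights (Sum.inl i) * d.swingJac δs (Sum.inl i) (Sum.inl j) = 0 := fun i => by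
      simp [swingJac, Matrix.fromBlocks_apply₁₁]
    have h2 : ∀ i, d.weights (Sum.inr i) * d.swingJac δs (Sum.inr i) (Sum.inl j)
        = -d.toDroopNetwork.lap δs j i := fun i => by
      simp only [weights, Sum.elim_inr, swingJac, Matrix.fromBlocks_apply₂₁]
      rw [lap_symm hB δs i j]
      field_simp [hM i]
    simp only [h1, h2, Finset.sum_const_zero, zero_add, Finset.sum_neg_distrib, hrow j, neg_zero]
  | inr j =>
    have h1 : ∀ i, d.weights (Sum.inl i) * d.swingJac δs (Sum.inl i) (Sum.inr j)
        = if i = j then d.D i else 0 := fun i => by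
      simp only [weights, Sum.elim_inl, swingJac, Matrix.fromBlocks_apply₁₂, Matrix.one_apply, mul_ite,
        mul_one, mul_zero]
    have h2 : ∀ i, d.weights (Sum.inr i) * d.swingJac δs (Sum.inr i) (Sum.inr j)
        = if i = j then -d.D i else 0 := fun i => by
      simp only [weights, Sum.elim_inr, swingJac, Matrix.fromBlocks_apply₂₂, Matrix.diagonal_apply, mul_ite,
        mul_zero]
      split_ifs with h
      · field_simp [hM i]
      · rfl
    simp only [h1, h2, Finset.sum_ite_eq', Finset.mem_univ, if_true, add_neg_cancel]

/-- `(D, M)·(𝟙, 0) = Σ_i D_i`. [folklore] -/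
private theorem weights_dotProduct_rot_eq : d.weights ⬝ᵥ rot = ∑ i, d.D i := by
  simp [dotProduct, Fintype.sum_sum_type, weights, rot]

/-! ### §2. The Lyapunov-matrix certificate at a cohesive lossless operating point is DERIVED -/

/-- ★★★ **THE LYAPUNOV-MATRIX CERTIFICATE OF THE LOSSY ROWS IS DERIVED AT EVERY COHESIVE LOSSLESS
OPERATING POINT** (Khalil Thm 4.6 necessity on the rotation quotient, by name over
`exists_lyapunovMatrix_of_eig_re_neg_or_smul` and the lossless spectral sentence
`swingJac_eig_re_neg_or_rotation`): classical network-reduced swing model, `M_i, D_i > 0`, `B`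
symmetric, couplings `C_ij = E_iE_jB_ij ≥ 0` connected, an angle vector `δˢ` with `|δˢ_i − δˢ_j| < π/2`
across every line, ANY reference machine `i₀`.  Then there are a real symmetric `P ≻ 0` on the phase
space and `q₀ > 0` with `uᵀP(J(δˢ)u − u_{ω,i₀}(𝟙,0)) ≤ −q₀uᵀu` on `{u_{δ,i₀} = 0}` — exactly the
hypothesis `hpos ∧ hlyap` of `syncEquilibrium_locally_expStable_lossy_of_lyapunovCertificate`.
[cite: Khalil2002, Theorem 4.6 and Theorem 4.7 (part 1); DorflerChertkovBullo2013, SI §3.1 Lemma 2; SchifferEtAl2014, §5.2 (reference node)] -/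
theorem exists_lyapunovCertificate_of_cohesive (hM : ∀ i, 0 < d.M i) (hD : ∀ i, 0 < d.D i)
    (hB : ∀ i j, d.B i j = d.B j i) (hC : ∀ i j, 0 ≤ d.C i j)
    (hconn : ClassicalModel.CouplingConnected d.C) {δs : Fin m → ℝ}
    (harc : ∀ i j, i ≠ j → 0 < d.C i j → |δs i - δs j| < Real.pi / 2) (i₀ : Fin m) :
    ∃ P : Matrix (Fin m ⊕ Fin m) (Fin m ⊕ Fin m) ℝ, P.IsSymm ∧ ∃ q₀ > 0,
      (∀ u : Fin m ⊕ Fin m → ℝ, u ≠ 0 → 0 < u ⬝ᵥ (P *ᵥ u)) ∧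
      ∀ u : Fin m ⊕ Fin m → ℝ, u (Sum.inl i₀) = 0 →
        u ⬝ᵥ (P *ᵥ (d.swingJac δs *ᵥ u - u (Sum.inr i₀) • rot)) ≤ -(q₀ * (u ⬝ᵥ u)) := by
  have hJr := swingJac_mulVec_rot (d := d) δs
  have hl₀J := weights_vecMul_swingJac (fun i => (hM i).ne') hB δs
  have hl₀r : d.weights ⬝ᵥ rot ≠ 0 := by
    rw [weights_dotProduct_rot_eq]
    exact (Finset.sum_pos (fun i _ => hD i) ⟨i₀, Finset.mem_univ _⟩).ne'
  have hlr : (Pi.single (Sum.inl i₀) (1 : ℝ) : Fin m ⊕ Fin m → ℝ) ⬝ᵥ rot ≠ 0 := by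
    rw [single_dotProduct, one_mul]; exact one_ne_zero
  have hJ : ∀ (μ : ℂ) (v : Fin m ⊕ Fin m → ℂ), v ≠ 0 →
      ((d.swingJac δs).map ((↑) : ℝ → ℂ)) *ᵥ v = μ • v →
      μ.re < 0 ∨ (μ = 0 ∧ ∃ a : ℂ, v = fun i => a * (rot i : ℂ)) :=
    fun μ v hv h => swingJac_eig_re_neg_or_rotation hM hD hB hC hconn harc hv h
  obtain ⟨P, hPs, q₀, hq₀, hpos, hly⟩ :=
    exists_lyapunovMatrix_of_eig_re_neg_or_smul hJr hl₀J hl₀r hlr hJ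
  refine ⟨P, hPs, q₀, hq₀, hpos, fun u hu => ?_⟩
  have h := hly u (by rw [single_dotProduct, one_mul]; exact hu)
  rw [single_dotProduct, one_mul, single_dotProduct, one_mul, swingJac_mulVec_inl] at h
  have hrot : (rot : Fin m ⊕ Fin m → ℝ) (Sum.inl i₀) = 1 := rfl
  rwa [hrot, div_one] at h

/-! ### §3. PERSISTENCE: every internal-node model whose equilibrium Jacobian is entrywise close to
the cohesive lossless Jacobian is locally exponentially stable modulo the rotation -/

/-- ★★★ **EXPONENTIAL STABILITY MODULO ROTATION PERSISTS UNDER SMALL PERTURBATIONS OF THE JACOBIAN —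
IN PARTICULAR UNDER SUFFICIENTLY SMALL TRANSFER CONDUCTANCES** («since the eigenvalues of a matrix are
continuous functions of its entries, the exponential stability property … is robust, and the stable
synchronous solution persists in the presence of sufficiently small line conductances [HDC-CCC:95]»,
here by Khalil's robust Lyapunov-matrix certificate rather than eigenvalue continuity): under the
hypotheses of `exists_lyapunovCertificate_of_cohesive` there is `δ₀ > 0` (depending on the lossless
data and `δˢ` only) such that for EVERY internal-node model `d'` on the same machines — any transfer
conductances, any injections — and every equilibrium `δˢ'` of `d'` whose Jacobian `J'(δˢ')`
(`swingJacG`) is entrywise `δ₀`-close to the lossless `J(δˢ)`, every solution of `d'` starting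
`ρ`-close to `(δˢ', ω_s𝟙)` converges exponentially to a rotated copy of it (the conclusion of
`syncEquilibrium_locally_expStable_lossy_of_lyapunovCertificate`, certificate margin `q₀/2`).
[cite: SimpsonporcoDorflerBullo2013, §3 remark after Theorem 2 (held text arXiv:1206.5033 p0010 L22) citing Chiang–Chu 1995 [HDC-CCC:95]; DorflerBullo2012, §I (arXiv:0910.5673 p0008 L39–L40: «can also be extended to "sufficiently small" transfer conductances [HDC-CCC:95]»); Khalil2002, §9.1 Lemma 9.1 / Example 9.1 with Theorem 4.6–4.7; Chiang1995, §6.1] -/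
theorem lossy_expStable_modRotation_of_jacobian_close (hM : ∀ i, 0 < d.M i) (hD : ∀ i, 0 < d.D i)
    (hB : ∀ i j, d.B i j = d.B j i) (hC : ∀ i j, 0 ≤ d.C i j)
    (hconn : ClassicalModel.CouplingConnected d.C) {δs : Fin m → ℝ}
    (harc : ∀ i j, i ≠ j → 0 < d.C i j → |δs i - δs j| < Real.pi / 2) (i₀ : Fin m) :
    ∃ δ₀ > 0, ∀ (d' : InternalNode m) (δs' : Fin m → ℝ), d'.IsEquilibrium δs' →
      (∀ k l, |d'.swingJacG δs' k l - d.swingJac δs k l| ≤ δ₀) →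
      ∃ ρ > 0, ∃ k > 0, ∃ lam > 0, ∀ δ ω : ℝ → Fin m → ℝ, (∀ t, d'.IsSolutionAt δ ω t) →
        ‖phase (δ 0 - δs') (fun i => ω 0 i - d'.ωs)‖ < ρ →
        ∀ T : ℝ, 0 ≤ T → ∃ c : ℝ, ∀ t ∈ Icc 0 T,
          ‖phase (fun i => δ t i - (δs' i + c)) (fun i => ω t i - d'.ωs)‖
            ≤ k * ‖phase (δ 0 - δs') (fun i => ω 0 i - d'.ωs)‖ * Real.exp (-lam * t) := by
  obtain ⟨P, hPs, q₀, hq₀, hpos, hly⟩ := exists_lyapunovCertificate_of_cohesive hM hD hB hC hconn harc i₀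
  set S : ℝ := (Fintype.card (Fin m ⊕ Fin m) : ℝ) * ∑ i, ∑ j, |P i j| with hS_def
  have hS : 0 ≤ S :=
    mul_nonneg (Nat.cast_nonneg _) (Finset.sum_nonneg fun i _ => Finset.sum_nonneg fun j _ => abs_nonneg _)
  refine ⟨q₀ / (2 * (S + 1)), by positivity, fun d' δs' hδs' hclose => ?_⟩
  have hδ : q₀ / (2 * (S + 1)) * S ≤ q₀ / 2 := by
    have h1 : S / (S + 1) ≤ 1 := by rw [div_le_one (by linarith)]; linarith
    have h2 : q₀ / (2 * (S + 1)) * S = q₀ / 2 * (S / (S + 1)) := by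
      field_simp
    rw [h2]
    exact (mul_le_mul_of_nonneg_left h1 (by linarith)).trans_eq (mul_one _)
  exact syncEquilibrium_locally_expStable_lossy_of_lyapunovCertificate i₀ hδs' hPs (half_pos hq₀)
    (fun u _ hne => hpos u hne)
    (fun u hu => lyapunovIneq_of_entries_close hq₀.le (hly u hu) hclose hδ)


/-! ### §4. SMALL TRANSFER CONDUCTANCES, explicitly: the same machines with ANY conductance matrix
`G'` and ANY injections, `|G'_ij| ≤ ε`, and an equilibrium within `ε` of the cohesive lossless one -/

/-- The linearised weight moves by at most `ε|E_iE_j|(2|B_ij| + 1)` when `|G'| ≤ ε` and the angles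
move by at most `ε` (`cos` is 1-Lipschitz, `|sin| ≤ 1`). [folklore] -/
private theorem lossyWeight_sub_linWeight_le {δs δs' : Fin m → ℝ} {Pm' : Fin m → ℝ}
    {G' : Fin m → Fin m → ℝ} {ε : ℝ} (hG : ∀ i j, |G' i j| ≤ ε) (hδ : ∀ i, |δs' i - δs i| ≤ ε)
    (i j : Fin m) :
    |(⟨d.H, d.D, Pm', d.E, G', d.B, d.ωs⟩ : InternalNode m).lossyWeight δs' i j
        - d.toDroopNetwork.linWeight δs i j|
      ≤ ε * (|d.E i * d.E j| * (2 * |d.B i j| + 1)) := by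
  have hε : 0 ≤ ε := (abs_nonneg _).trans (hδ i)
  have hcos := Real.abs_cos_sub_cos_le (δs' i - δs' j) (δs i - δs j)
  have hsin := Real.abs_sin_le_one (δs' i - δs' j)
  have hang : |δs' i - δs' j - (δs i - δs j)| ≤ 2 * ε := by
    have h := abs_sub (δs' i - δs i) (δs' j - δs j)
    have h' : δs' i - δs' j - (δs i - δs j) = (δs' i - δs i) - (δs' j - δs j) := by ring
    rw [h']; linarith [hδ i, hδ j]
  have hexp : (⟨d.H, d.D, Pm', d.E, G', d.B, d.ωs⟩ : InternalNode m).lossyWeight δs' i j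
        - d.toDroopNetwork.linWeight δs i j
      = d.E i * d.E j * (d.B i j * (Real.cos (δs' i - δs' j) - Real.cos (δs i - δs j)))
        - d.E i * d.E j * (G' i j * Real.sin (δs' i - δs' j)) := by
    simp only [lossyWeight, DroopNetwork.linWeight, toDroopNetwork_a, C]; ring
  rw [hexp]
  refine (abs_sub _ _).trans ?_
  rw [abs_mul (d.E i * d.E j), abs_mul (d.E i * d.E j), abs_mul (d.B i j), abs_mul (G' i j)]
  have hEE : 0 ≤ |d.E i * d.E j| := abs_nonneg _
  have h1 : |d.B i j| * |Real.cos (δs' i - δs' j) - Real.cos (δs i - δs j)| ≤ |d.B i j| * (2 * ε) :=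
    mul_le_mul_of_nonneg_left (hcos.trans hang) (abs_nonneg _)
  have h2 : |G' i j| * |Real.sin (δs' i - δs' j)| ≤ ε * 1 :=
    mul_le_mul (hG i j) hsin (abs_nonneg _) hε
  nlinarith [mul_le_mul_of_nonneg_left h1 hEE, mul_le_mul_of_nonneg_left h2 hEE]

/-- Entrywise distance of the lossy Jacobian at `δˢ'` from the lossless Jacobian at `δˢ`:
`≤ 2εW·Σ_i M_i⁻¹` with `W = Σ_{i,k} |E_iE_k|(2|B_ik| + 1)`. [folklore] -/
private theorem swingJacG_sub_swingJac_le (hM : ∀ i, 0 < d.M i) {δs δs' : Fin m → ℝ}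
    {Pm' : Fin m → ℝ} {G' : Fin m → Fin m → ℝ} {ε : ℝ} (hG : ∀ i j, |G' i j| ≤ ε)
    (hδ : ∀ i, |δs' i - δs i| ≤ ε) (k l : Fin m ⊕ Fin m) :
    |(⟨d.H, d.D, Pm', d.E, G', d.B, d.ωs⟩ : InternalNode m).swingJacG δs' k l - d.swingJac δs k l|
      ≤ 2 * ε * (∑ i, ∑ j, |d.E i * d.E j| * (2 * |d.B i j| + 1)) * ∑ i, (d.M i)⁻¹ := by
  set d' : InternalNode m := ⟨d.H, d.D, Pm', d.E, G', d.B, d.ωs⟩ with hd'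
  set W : ℝ := ∑ i, ∑ j, |d.E i * d.E j| * (2 * |d.B i j| + 1) with hW
  set Δ : Fin m → Fin m → ℝ := fun i j => d'.lossyWeight δs' i j - d.toDroopNetwork.linWeight δs i j
    with hΔ
  have hε : 0 ≤ ε := (abs_nonneg _).trans (hδ (k.elim id id))
  have hterm : ∀ i j, 0 ≤ |d.E i * d.E j| * (2 * |d.B i j| + 1) := fun i j =>
    mul_nonneg (abs_nonneg _) (by positivity)
  have hW0 : 0 ≤ W := Finset.sum_nonneg fun i _ => Finset.sum_nonneg fun j _ => hterm i j
  have hMinv : 0 ≤ ∑ i, (d.M i)⁻¹ := Finset.sum_nonneg fun i _ => (inv_pos.2 (hM i)).le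
  have hΔle : ∀ i j, |Δ i j| ≤ ε * W := fun i j => by
    refine (lossyWeight_sub_linWeight_le (d := d) hG hδ i j).trans (mul_le_mul_of_nonneg_left ?_ hε)
    exact (Finset.single_le_sum (fun j _ => hterm i j) (Finset.mem_univ j)).trans
      (Finset.single_le_sum (fun i _ => Finset.sum_nonneg fun j _ => hterm i j) (Finset.mem_univ i))
  have hΔsum : ∀ i, |∑ j, Δ i j| ≤ ε * W := fun i => by
    refine (Finset.abs_sum_le_sum_abs _ _).trans ?_
    calc ∑ j, |Δ i j| ≤ ∑ j, ε * (|d.E i * d.E j| * (2 * |d.B i j| + 1)) :=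
          Finset.sum_le_sum fun j _ => lossyWeight_sub_linWeight_le (d := d) hG hδ i j
      _ = ε * ∑ j, |d.E i * d.E j| * (2 * |d.B i j| + 1) := by rw [Finset.mul_sum]
      _ ≤ ε * W := mul_le_mul_of_nonneg_left
          (Finset.single_le_sum (fun i _ => Finset.sum_nonneg fun j _ => hterm i j) (Finset.mem_univ i)) hε
  have hbound : 0 ≤ 2 * ε * W * ∑ i, (d.M i)⁻¹ := by positivity
  have hM' : ∀ i, d'.M i = d.M i := fun i => rfl
  have hD' : ∀ i, d'.D i = d.D i := fun i => rfl
  cases k with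
  | inl i =>
    cases l with
    | inl j => simpa [swingJacG, swingJac, Matrix.fromBlocks_apply₁₁] using hbound
    | inr j => simpa [swingJacG, swingJac, Matrix.fromBlocks_apply₁₂] using hbound
  | inr i =>
    cases l with
    | inr j =>
      simpa [swingJacG, swingJac, Matrix.fromBlocks_apply₂₂, Matrix.diagonal_apply, hM', hD'] using hbound
    | inl j =>
      have hentry : d'.swingJacG δs' (Sum.inr i) (Sum.inl j) - d.swingJac δs (Sum.inr i) (Sum.inl j)
          = -((if i = j then ∑ k, Δ i k else 0) - Δ i j) / d.M i := by
        simp only [swingJacG, swingJac, Matrix.fromBlocks_apply₂₁, DroopNetwork.lap, hΔ, hM',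
          Finset.sum_sub_distrib]
        split_ifs <;> ring
      rw [hentry, abs_div, abs_neg, abs_of_pos (hM i)]
      have hnum : |(if i = j then ∑ k, Δ i k else 0) - Δ i j| ≤ 2 * ε * W := by
        refine (abs_sub _ _).trans ?_
        split_ifs
        · linarith [hΔsum i, hΔle i j]
        · rw [abs_zero]; linarith [hΔle i j, mul_nonneg hε hW0]
      rw [div_le_iff₀ (hM i)]
      have hinv : (d.M i)⁻¹ ≤ ∑ k, (d.M k)⁻¹ :=
        Finset.single_le_sum (fun k _ => (inv_pos.2 (hM k)).le) (Finset.mem_univ i)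
      calc |(if i = j then ∑ k, Δ i k else 0) - Δ i j| ≤ 2 * ε * W := hnum
        _ = 2 * ε * W * (d.M i)⁻¹ * d.M i := by rw [mul_assoc (2 * ε * W), inv_mul_cancel₀ (hM i).ne', mul_one]
        _ ≤ 2 * ε * W * (∑ k, (d.M k)⁻¹) * d.M i :=
          mul_le_mul_of_nonneg_right (mul_le_mul_of_nonneg_left hinv (by positivity)) (hM i).le

/-- ★★★ **CHIANG–CHU PERSISTENCE, TYPED: THE COHESIVE OPERATING POINT STAYS EXPONENTIALLY STABLE UNDER
SUFFICIENTLY SMALL TRANSFER CONDUCTANCES.**  Classical network-reduced swing model `d` (`M_i, D_i >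
0`, `B` symmetric, `C_ij = E_iE_jB_ij ≥ 0` connected), a cohesive angle vector `δˢ` (`|δˢ_i − δˢ_j| <
π/2` across lines), a reference machine `i₀`.  There is `ε > 0` such that: for EVERY conductance
matrix `G'` with `|G'_ij| ≤ ε` and every vector of mechanical inputs `P'_m`, every equilibrium `δˢ'`
of the LOSSY model `⟨H, D, P'_m, E, G', B, ω_s⟩` with `|δˢ'_i − δˢ_i| ≤ ε` is locally exponentially
stable modulo the rotation (every solution starting `ρ`-close converges exponentially to a rotated
copy of `(δˢ', ω_s𝟙)`).  The EXISTENCE of such a nearby equilibrium (implicit function theorem) is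
not asserted here — the statement covers whatever equilibrium the lossy model has near `δˢ`.
[cite: SimpsonporcoDorflerBullo2013, §3 remark after Theorem 2 (arXiv:1206.5033 p0010 L22: «the stable synchronous solution persists in the presence of sufficiently small line conductances [HDC-CCC:95]»); DorflerBullo2012, §I (arXiv:0910.5673 p0008 L39–L40); Chiang1995, §6.1; Khalil2002, Theorem 4.6–4.7, §9.1 Lemma 9.1] -/
theorem lossy_expStable_modRotation_of_small_conductances (hM : ∀ i, 0 < d.M i)
    (hD : ∀ i, 0 < d.D i) (hB : ∀ i j, d.B i j = d.B j i) (hC : ∀ i j, 0 ≤ d.C i j)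
    (hconn : ClassicalModel.CouplingConnected d.C) {δs : Fin m → ℝ}
    (harc : ∀ i j, i ≠ j → 0 < d.C i j → |δs i - δs j| < Real.pi / 2) (i₀ : Fin m) :
    ∃ ε > 0, ∀ (Pm' : Fin m → ℝ) (G' : Fin m → Fin m → ℝ) (δs' : Fin m → ℝ),
      (∀ i j, |G' i j| ≤ ε) → (∀ i, |δs' i - δs i| ≤ ε) →
      (⟨d.H, d.D, Pm', d.E, G', d.B, d.ωs⟩ : InternalNode m).IsEquilibrium δs' →
      ∃ ρ > 0, ∃ k > 0, ∃ lam > 0, ∀ δ ω : ℝ → Fin m → ℝ,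
        (∀ t, (⟨d.H, d.D, Pm', d.E, G', d.B, d.ωs⟩ : InternalNode m).IsSolutionAt δ ω t) →
        ‖phase (δ 0 - δs') (fun i => ω 0 i - d.ωs)‖ < ρ →
        ∀ T : ℝ, 0 ≤ T → ∃ c : ℝ, ∀ t ∈ Icc 0 T,
          ‖phase (fun i => δ t i - (δs' i + c)) (fun i => ω t i - d.ωs)‖
            ≤ k * ‖phase (δ 0 - δs') (fun i => ω 0 i - d.ωs)‖ * Real.exp (-lam * t) := by
  obtain ⟨δ₀, hδ₀, hstab⟩ := lossy_expStable_modRotation_of_jacobian_close hM hD hB hC hconn harc i₀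
  set W : ℝ := ∑ i, ∑ j, |d.E i * d.E j| * (2 * |d.B i j| + 1) with hW
  set Minv : ℝ := ∑ i, (d.M i)⁻¹ with hMinv
  have hW0 : 0 ≤ W := Finset.sum_nonneg fun i _ => Finset.sum_nonneg fun j _ =>
    mul_nonneg (abs_nonneg _) (by positivity)
  have hMinv0 : 0 ≤ Minv := Finset.sum_nonneg fun i _ => (inv_pos.2 (hM i)).le
  refine ⟨δ₀ / (2 * W * Minv + 1), by positivity, fun Pm' G' δs' hG hδ heq => ?_⟩
  have hclose : ∀ k l, |(⟨d.H, d.D, Pm', d.E, G', d.B, d.ωs⟩ : InternalNode m).swingJacG δs' k l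
      - d.swingJac δs k l| ≤ δ₀ := fun k l => by
    refine (swingJacG_sub_swingJac_le (d := d) hM hG hδ k l).trans ?_
    have h1 : 2 * (δ₀ / (2 * W * Minv + 1)) * W * Minv = δ₀ * (2 * W * Minv / (2 * W * Minv + 1)) := by
      field_simp
    have h2 : 2 * W * Minv / (2 * W * Minv + 1) ≤ 1 := by
      rw [div_le_one (by positivity)]; linarith [mul_nonneg (mul_nonneg zero_le_two hW0) hMinv0]
    rw [h1]
    exact (mul_le_mul_of_nonneg_left h2 hδ₀.le).trans_eq (mul_one _)
  exact hstab _ δs' heq hclose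

end InternalNode

end Literature.MathematicalPhysics.PowerSystems
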